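import Mathlib.NumberTheory.Padics.RingHoms
import Literature.LinearAlgebra.Matrix.CongruenceTorsionFree
import Literature.NumberTheory.EllipticCurves.TateCurvePointsUniformization
import HarnessLib

/-!
# `E(ℚ_p)[p] ≠ 0` at a split multiplicative odd prime `p` iff the Tate parameter is a `p`-th power

Topic `NumberTheory/EllipticCurves`. Theorems only: **no definition and no named fact is introduced**
(D-0014 / D-0026); everything below the registered named fact
`Literature.NumberTheory.EllipticCurves.tateUniformization_points` (Tate's `p`-adic uniformization
`E(ℚ_p) ≅ ℚ_p^× / q^ℤ`, Silverman *ATAEC* Thm. V.3.1 (d) / V.5.3, file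
`TateCurvePointsUniformization.lean`) is consumed as the hypothesis `(hT : tateUniformization_points)`.

For an ODD prime `p`, `ℚ_p` contains no primitive `p`-th root of unity (Serre, *A Course in
Arithmetic*, Ch. II §3.2, Thm. 2: `ℚ_p^* ≅ ℤ × ℤ_p × ℤ/(p-1)ℤ` for `p ≠ 2` — store
`book:serre1973-course-arithmetic` p0017 L41; Prop. 8 ibid.: `U₁ ≅ ℤ_p` for `p ≠ 2`), hence for
`q ∈ ℚ_p^×` with `|q| < 1` the `p`-torsion of `ℚ_p^×/q^ℤ` is non-trivial iff `q ∈ (ℚ_p^×)^p`, and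
through Tate's uniformization: **for `E/ℚ` split multiplicative at `p` with Tate parameter `q_E`,
`E(ℚ_p)[p] ≠ 0 ⟺ q_E` is a `p`-th power in `ℚ_p`.** This is the local-torsion test that decides
the hypothesis "`E(ℚ_p)[p] = 0`" of the rank-one `p`-converse theorems at a multiplicative prime
(Skinner–Zhang, arXiv:1407.1099, Thm. 1.1 (b): "`p ∤ ord_p(q_E)` and `log_p q_E ∈ pℤ_p^×`" implies it;
Castella, Camb. J. Math. 6 (2018) erratum, Thm. A′ (2)) and the membership of a split curve in the
Tate-fifth-power set `T₅` of the BSD-DENSITY SPRINT's res-cell (cell `b2b-bsdres`, book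
`cells/density/CONVERSION-QUEUE.md` row Q4/Q4′: on `SP′ = S₀(5) ∖ (S₁′(5) ∪ T₅)` one needs
`E(ℚ₅)[5] = 0`; the non-split and the `p ∤ v_p(Δ_min)` cases are the summit cone's
`Summit.BirchSwinnertonDyer.Rank1Residual.X11b.LocalTorsion.localTorsion_eq_zero_of_mult`, every
`p ≥ 3`; the split case with `p ∣ v_p(Δ_min)` is THIS test). The case `p = 3` is the summit cone's
`Summit.BirchSwinnertonDyer.Rank1Residual.X11b.Three.three_torsion_ne_zero_iff_isCube`
(`μ₃(ℚ₃) = 1` by hand); here `p` is any odd prime, Literature-side.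

## What is proved

* `TatePrimeTorsion.eq_one_of_pow_prime_eq_one` — **`μ_p(ℚ_p) = 1` for odd `p`**: `x ∈ ℚ_p`,
  `x^p = 1 ⟹ x = 1` (`|x| = 1`; `x̄^p = x̄` in `𝔽_p` gives `x ≡ 1 (mod p)`; then the binomial
  computation — the tree's Minkowski lemma `Literature.LinearAlgebra.Matrix.eq_one_of_pow_prime_eq_one`
  over the domain `ℤ_p` with prime `π = p`, `π² ∤ p`, `p ≠ 2`, read for `1 × 1` matrices).
* (private) `zpow_eq_one_of_norm_lt_one` — `q ∈ ℚ_p^×`, `|q| < 1`, `q^n = 1 ⟹ n = 0`.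
* `TatePrimeTorsion.exists_torsion_quotient_iff` / `…_additive_iff` — **in `ℚ_p^×/q^ℤ` (`|q| < 1`,
  `p` odd) there is a non-trivial element killed by `p` iff `q = u^p` for some `u ∈ ℚ_p^×`**
  ((⇐) the class of `u`; (⇒) `u^p = q^k`: if `p ∣ k` then `u q^{-k/p} ∈ μ_p(ℚ_p) = 1`, else Bézout
  `a k + b p = 1` gives `(u^a q^b)^p = q`).
* `prime_torsion_ne_zero_iff_exists_pow_eq_tateParameter` — **for `E/ℚ`, an odd prime `p` and a
  Tate parameter datum `D` at `p` (so `p` is split multiplicative, `q_E = D.q`):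
  `(∃ P ∈ E(ℚ_p), P ≠ O, pP = O) ⟺ ∃ u ∈ ℚ_p, u^p = q_E`**, below `hT : tateUniformization_points`;
  with the readings `forall_prime_smul_eq_zero_iff_not_exists_pow_eq_tateParameter`
  (`E(ℚ_p)[p] = 0 ⟺ q_E ∉ (ℚ_p)^p`) and `natCard_ker_nsmul_eq_one_iff_not_exists_pow_eq_tateParameter`
  (`#E(ℚ_p)[p] = 1 ⟺ q_E ∉ (ℚ_p)^p`, the currency of `SelmerLocalRestrictionKernel.lean`'s
  `natCard_selmerGroup_le_prime_mul_of_natCard_torsion_eq_one`, up to the field isomorphism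
  `ℚ_v ≅ ℚ_p` — tree `Literature.Barriers.BirchSwinnertonDyer.pointEquivOfAlgEquiv` along Mathlib's
  `adicCompletion.padicEquiv`, not imported here).

## References

* [Serre1973] J.-P. Serre, *A Course in Arithmetic*, GTM 7 (1973), Ch. II §3.1–3.2: Prop. 7, Prop. 8,
  Thm. 2 (store `book:serre1973-course-arithmetic` p0016 L15, p0017 L17 / L41).
* [SilvermanATAEC1994] J. H. Silverman, *Advanced Topics in the Arithmetic of Elliptic Curves*,
  GTM 151 (1994), Thm. V.3.1 (c),(d), Thm. V.5.3 (the fact `tateUniformization_points`).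
* [SkinnerZhang2014] C. Skinner, W. Zhang, arXiv:1407.1099v1, Thm. 1.1 (b) (the hypothesis this test
  decides). [Castella2018Erratum] F. Castella, Thm. A′ (2) "`E(ℚ_p)[p] = 0`".
* [Brown1982CohomologyGroups] K. S. Brown, *Cohomology of Groups*, Ch. II §4 Ex. 3 (Minkowski's
  lemma; the tree's `CongruenceTorsionFree.lean`).
-/

noncomputable section

open scoped Classical

namespace Literature.NumberTheory.EllipticCurves

namespace TatePrimeTorsion

open Literature.LinearAlgebra.Matrix

variable {p : ℕ} [hp : Fact p.Prime]

/-! ### `μ_p(ℚ_p) = 1` for an odd prime `p` -/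

/-- Every non-zero `p`-adic integer has finite `p`-adic order: some power of `p` does not divide it
(`‖x‖ ≤ p^{-k}` for all `k` would force `x = 0`). [folklore] -/
private theorem exists_not_pow_dvd (x : ℤ_[p]) (hx : x ≠ 0) : ∃ k : ℕ, ¬ (p : ℤ_[p]) ^ k ∣ x := by
  by_contra h
  push Not at h
  have hpos : 0 < ‖x‖ := norm_pos_iff.mpr hx
  have hp1 : ((p : ℝ))⁻¹ < 1 := inv_lt_one_of_one_lt₀ (by exact_mod_cast hp.out.one_lt)
  obtain ⟨k, hk⟩ := exists_pow_lt_of_lt_one hpos hp1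
  have hle : ‖x‖ ≤ (p : ℝ) ^ (-(k : ℤ)) :=
    (PadicInt.norm_le_pow_iff_mem_span_pow x k).mpr (Ideal.mem_span_singleton.mpr (h k))
  rw [zpow_neg, zpow_natCast, ← inv_pow] at hle
  exact absurd (hle.trans_lt hk) (lt_irrefl _)

/-- `p² ∤ p` in `ℤ_p` (otherwise `p` would be a unit). [folklore] -/
private theorem not_sq_dvd_p : ¬ (p : ℤ_[p]) ^ 2 ∣ (p : ℤ_[p]) := by
  rintro ⟨c, hc⟩
  have hp0 : (p : ℤ_[p]) ≠ 0 := PadicInt.prime_p.ne_zero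
  have h1 : (1 : ℤ_[p]) = p * c := by
    have : (p : ℤ_[p]) * 1 = p * (p * c) := by rw [mul_one, ← mul_assoc, ← sq]; exact hc
    exact mul_left_cancel₀ hp0 this
  exact PadicInt.prime_p.not_unit (isUnit_iff_exists_inv.mpr ⟨c, h1.symm⟩)

/-- A `p`-adic INTEGER `y` with `y ≡ 1 (mod p)` and `y^p = 1` is `1`, for `p` odd — the binomial
computation `(1 + p^k z)^p ≡ 1 + p^{k+1} z (mod p^{k+2})`, i.e. the tree's Minkowski lemma
`Literature.LinearAlgebra.Matrix.eq_one_of_pow_prime_eq_one` over `ℤ_p` (`π = p`, `π² ∤ p`, `p ≠ 2`)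
for `1 × 1` matrices. Serre, *A Course in Arithmetic*, II §3.1 Prop. 8 (`U₁ ≅ ℤ_p`, torsion-free,
for `p ≠ 2`). [cite: Serre1973, Ch. II §3.1 Prop. 8] [cite: Brown1982CohomologyGroups, Ch. II §4, Exercise 3 (a)] -/
theorem PadicInt.eq_one_of_pow_prime_eq_one_of_dvd_sub_one (hp2 : p ≠ 2) {y : ℤ_[p]}
    (hdvd : (p : ℤ_[p]) ∣ y - 1) (hpow : y ^ p = 1) : y = 1 := by
  -- the `1 × 1` matrix `γ = (y)`
  set γ : Matrix Unit Unit ℤ_[p] := Matrix.diagonal fun _ => y with hγ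
  have hγpow : γ ^ p = 1 := by
    rw [hγ, Matrix.diagonal_pow]
    have : (fun _ : Unit => y) ^ p = fun _ => (1 : ℤ_[p]) := by
      funext i; simp [hpow]
    rw [this]
    exact Matrix.diagonal_one
  have hγ1 : EntryDvd (p : ℤ_[p]) (γ - 1) := by
    intro i j
    obtain rfl : i = j := Subsingleton.elim i j
    rw [Matrix.sub_apply, hγ, Matrix.diagonal_apply_eq, Matrix.one_apply_eq]
    exact hdvd
  have h := eq_one_of_pow_prime_eq_one (n := Unit) PadicInt.prime_p exists_not_pow_dvd hp.out
    (Or.inr ⟨not_sq_dvd_p, hp2⟩) hγ1 hγpow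
  have h' := congrFun (congrFun h ()) ()
  rw [hγ, Matrix.diagonal_apply_eq, Matrix.one_apply_eq] at h'
  exact h'

/-- **`μ_p(ℚ_p) = {1}` for an odd prime `p`**: if `x^p = 1` in `ℚ_p` then `x = 1`. (`‖x‖^p = 1`
forces `‖x‖ = 1`, so `x ∈ ℤ_p`; its reduction `x̄ ∈ 𝔽_p` satisfies `x̄ = x̄^p = 1`, i.e.
`x ≡ 1 (mod p)`; conclude by `PadicInt.eq_one_of_pow_prime_eq_one_of_dvd_sub_one`.) Serre,
*A Course in Arithmetic*, Ch. II §3.2 Thm. 2: "The group `ℚ_p^*` is isomorphic to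
`ℤ × ℤ_p × ℤ/(p-1)ℤ` if `p ≠ 2`" — so its torsion is cyclic of order `p - 1`, prime to `p`.
[cite: Serre1973, Ch. II §3.2 Thm. 2] -/
theorem eq_one_of_pow_prime_eq_one (hp2 : p ≠ 2) (x : ℚ_[p]) (hx : x ^ p = 1) : x = 1 := by
  have hnorm : ‖x‖ = 1 := by
    have h : ‖x‖ ^ p = 1 := by rw [← norm_pow, hx, norm_one]
    exact (pow_eq_one_iff_of_nonneg (norm_nonneg x) hp.out.ne_zero).mp h
  set y : ℤ_[p] := ⟨x, hnorm.le⟩ with hy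
  have hyx : (y : ℚ_[p]) = x := rfl
  have hypow : y ^ p = 1 := by
    apply Subtype.ext
    push_cast
    rw [hyx, hx]
  -- reduction mod `p`: `ȳ^p = ȳ` and `ȳ^p = 1`
  have hred : PadicInt.toZMod y = 1 := by
    have h1 : PadicInt.toZMod y ^ p = 1 := by rw [← map_pow, hypow, map_one]
    rwa [ZMod.pow_card] at h1
  have hdvd : (p : ℤ_[p]) ∣ y - 1 := by
    have hker : y - 1 ∈ RingHom.ker (PadicInt.toZMod : ℤ_[p] →+* ZMod p) := by
      rw [RingHom.mem_ker, map_sub, hred, map_one, sub_self]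
    rw [PadicInt.ker_toZMod, PadicInt.maximalIdeal_eq_span_p] at hker
    exact Ideal.mem_span_singleton.mp hker
  have hy1 := PadicInt.eq_one_of_pow_prime_eq_one_of_dvd_sub_one hp2 hdvd hypow
  rw [← hyx, hy1]
  rfl

/-! ### `p`-torsion in `ℚ_p^× / q^ℤ` -/

/-- An element `q ∈ ℚ_p^×` with `‖q‖ < 1` has infinite order: `q^n = 1 ⟹ n = 0`. [folklore] -/
private theorem zpow_eq_one_of_norm_lt_one {q : ℚ_[p]ˣ} (hq : ‖(q : ℚ_[p])‖ < 1) (n : ℤ)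
    (h : q ^ n = 1) : n = 0 := by
  have hpos : 0 < ‖(q : ℚ_[p])‖ := norm_pos_iff.mpr q.ne_zero
  have hval : ‖(q : ℚ_[p])‖ ^ n = 1 := by
    rw [← norm_zpow, ← Units.val_zpow_eq_zpow_val, h, Units.val_one, norm_one]
  rcases lt_trichotomy n 0 with hn | hn | hn
  · exact absurd hval (one_lt_zpow_of_neg₀ hpos hq hn).ne'
  · exact hn
  · exact absurd hval (zpow_lt_one₀ hpos hq hn).ne

/-- **`p`-torsion in `ℚ_p^×/q^ℤ` (`‖q‖ < 1`, `p` odd) is non-trivial iff `q` is a `p`-th power in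
`ℚ_p^×`.** (⇐) the class of a `p`-th root `u` of `q` is killed by `p` and is non-trivial (`u ∈ q^ℤ`
would give `q^{pk-1} = 1`). (⇒) a non-trivial class `[u]` with `u^p = q^k`: if `p ∣ k`, `k = pm`,
then `u q^{-m}` is a `p`-th root of unity, hence `1` (`eq_one_of_pow_prime_eq_one`), so `[u]` is
trivial; otherwise `a k + b p = 1` (Bézout) and `(u^a q^b)^p = q^{ak+bp} = q`. Serre, *A Course in
Arithmetic*, Ch. II §3.2 Thm. 2 (the structure of `ℚ_p^*`, `p ≠ 2`). [cite: Serre1973, Ch. II §3.2 Thm. 2] -/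
theorem exists_torsion_quotient_iff (hp2 : p ≠ 2) {q : ℚ_[p]ˣ} (hq : ‖(q : ℚ_[p])‖ < 1) :
    (∃ x : ℚ_[p]ˣ ⧸ Subgroup.zpowers q, x ≠ 1 ∧ x ^ p = 1) ↔ ∃ u : ℚ_[p]ˣ, u ^ p = q := by
  constructor
  · rintro ⟨x, hx1, hxp⟩
    obtain ⟨u, rfl⟩ := QuotientGroup.mk_surjective x
    have hmem : u ^ p ∈ Subgroup.zpowers q := by
      rw [← QuotientGroup.eq_one_iff, QuotientGroup.mk_pow]; exact hxp
    obtain ⟨k, hk⟩ := Subgroup.mem_zpowers_iff.mp hmem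
    have hnot : u ∉ Subgroup.zpowers q := fun h ↦ hx1 ((QuotientGroup.eq_one_iff u).mpr h)
    -- `u ^ p` as an integer power
    have hup : u ^ (p : ℤ) = q ^ k := by rw [zpow_natCast, hk]
    by_cases hpk : (p : ℤ) ∣ k
    · -- `k = p m`: `(u q^{-m})^p = 1`, so `u = q^m ∈ q^ℤ`
      exfalso
      obtain ⟨m, hm⟩ := hpk
      have hw : (u * q ^ (-m)) ^ p = 1 := by
        rw [← zpow_natCast, mul_zpow, hup, ← zpow_mul, hm, ← zpow_add, neg_mul,
          mul_comm m (p : ℤ), add_neg_cancel, zpow_zero]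
      have hw1 : ((u * q ^ (-m) : ℚ_[p]ˣ) : ℚ_[p]) = 1 := by
        apply eq_one_of_pow_prime_eq_one hp2
        rw [← Units.val_pow_eq_pow_val, hw, Units.val_one]
      have hu : u = q ^ m := by
        have h1 : u * q ^ (-m) = 1 := Units.val_eq_one.mp hw1
        rw [zpow_neg] at h1
        exact mul_inv_eq_one.mp h1
      exact hnot (Subgroup.mem_zpowers_iff.mpr ⟨m, hu.symm⟩)
    · -- Bézout: `a k + b p = 1`, `(u^a q^b)^p = q`
      have hcop : IsCoprime k (p : ℤ) := by
        rw [Int.isCoprime_iff_gcd_eq_one]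
        have hpZ : Prime (p : ℤ) := Nat.prime_iff_prime_int.mp hp.out
        have hg : (Int.gcd k p : ℤ) ∣ (p : ℤ) := Int.gcd_dvd_right k p
        have hg' : (Int.gcd k p : ℤ) ∣ k := Int.gcd_dvd_left k p
        rcases (Nat.dvd_prime hp.out).mp (by exact_mod_cast hg : Int.gcd k p ∣ p) with h1 | h2
        · exact h1
        · exfalso
          apply hpk
          rw [← h2]
          exact hg'
      obtain ⟨a, b, hab⟩ := hcop
      refine ⟨u ^ a * q ^ b, ?_⟩
      rw [← zpow_natCast, mul_zpow, ← zpow_mul, ← zpow_mul, mul_comm a (p : ℤ), zpow_mul, hup,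
        ← zpow_mul, ← zpow_add, show k * a + b * (p : ℤ) = 1 by linarith [hab], zpow_one]
  · rintro ⟨u, hu⟩
    refine ⟨QuotientGroup.mk u, ?_, ?_⟩
    · intro h1
      obtain ⟨k, hk⟩ := Subgroup.mem_zpowers_iff.mp ((QuotientGroup.eq_one_iff u).mp h1)
      -- `q = u^p = q^{pk}`, so `q^{pk-1} = 1`, contradiction
      have h : q ^ (k * p - 1) = 1 := by
        rw [zpow_sub_one, zpow_mul, hk, zpow_natCast, hu, mul_inv_cancel]
      have h0 := zpow_eq_one_of_norm_lt_one hq _ h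
      have hp1 : (1 : ℤ) < p := by exact_mod_cast hp.out.one_lt
      have : k * (p : ℤ) = 1 := by linarith
      have hk1 : k = 1 ∧ (p : ℤ) = 1 ∨ k = -1 ∧ (p : ℤ) = -1 := Int.mul_eq_one_iff_eq_one_or_neg_one.mp this
      rcases hk1 with ⟨-, h1⟩ | ⟨-, h1⟩ <;> linarith
    · rw [← QuotientGroup.mk_pow, hu]
      exact (QuotientGroup.eq_one_iff (q : ℚ_[p]ˣ)).mpr (Subgroup.mem_zpowers q)

/-- Additive reading: in `Additive (ℚ_p^×/q^ℤ)` (`‖q‖ < 1`, `p` odd) there is a non-zero element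
killed by `p` iff `q` is a `p`-th power. [cite: Serre1973, Ch. II §3.2 Thm. 2] -/
theorem exists_torsion_additive_iff (hp2 : p ≠ 2) {q : ℚ_[p]ˣ} (hq : ‖(q : ℚ_[p])‖ < 1) :
    (∃ y : Additive (ℚ_[p]ˣ ⧸ Subgroup.zpowers q), y ≠ 0 ∧ p • y = 0) ↔
      ∃ u : ℚ_[p]ˣ, u ^ p = q := by
  rw [← exists_torsion_quotient_iff hp2 hq]
  constructor
  · rintro ⟨y, hy0, hyp⟩
    refine ⟨Additive.toMul y, fun h ↦ hy0 ?_, ?_⟩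
    · have h' := congrArg Additive.ofMul h
      rwa [ofMul_toMul, ofMul_one] at h'
    · rw [← toMul_nsmul, hyp, toMul_zero]
  · rintro ⟨x, hx1, hxp⟩
    refine ⟨Additive.ofMul x, fun h ↦ hx1 ?_, ?_⟩
    · have h' := congrArg Additive.toMul h
      rwa [toMul_ofMul, toMul_zero] at h'
    · rw [← ofMul_pow, hxp, ofMul_one]

end TatePrimeTorsion

/-! ### The curve: `E(ℚ_p)[p] ≠ 0 ⟺ q_E ∈ (ℚ_p)^p` at a split multiplicative odd `p` -/

section Curve

open WeierstrassCurve TatePrimeTorsion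

variable {p : ℕ} [hp : Fact p.Prime] (W : WeierstrassCurve ℚ) [W.IsElliptic]

/-- **Split multiplicative odd `p`: `E(ℚ_p)[p] ≠ 0` iff the Tate parameter is a `p`-th power.** For
`E/ℚ` with a Tate parameter datum `D` at the odd prime `p` (so `p` is SPLIT multiplicative,
`q_E = D.q`, `0 < ‖q_E‖ < 1`, `j(q_E) = j(E)`): there is a non-zero `P ∈ E(ℚ_p)` with `pP = O` iff
`q_E = u^p` for some `u ∈ ℚ_p`. Through Tate's uniformization `E(ℚ_p) ≅ ℚ_p^×/q_E^ℤ` — the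
registered named fact `tateUniformization_points` (Silverman *ATAEC* Thm. V.3.1 (d), V.5.3), taken
as the hypothesis `hT` — this is `TatePrimeTorsion.exists_torsion_additive_iff` (`μ_p(ℚ_p) = 1`,
Serre II §3.2 Thm. 2). The `p = 3` case is the summit cone's
`X11b.Three.three_torsion_ne_zero_iff_isCube`. CONDITIONAL on `hT` only.
[cite: SilvermanATAEC1994, Thm. V.3.1 (d) and Thm. V.5.3] [cite: Serre1973, Ch. II §3.2 Thm. 2] -/
theorem prime_torsion_ne_zero_iff_exists_pow_eq_tateParameter (hT : tateUniformization_points)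
    (hp2 : p ≠ 2) (D : WeierstrassCurve.TateParameterData W p) :
    (∃ P : (W.baseChange ℚ_[p]).toAffine.Point, P ≠ 0 ∧ p • P = 0) ↔
      ∃ u : ℚ_[p], u ^ p = D.q := by
  obtain ⟨f, hbij, hadd⟩ := hT W p D
  have hq : ‖((Units.mk0 D.q D.q_ne_zero : ℚ_[p]ˣ) : ℚ_[p])‖ < 1 := by
    rw [Units.val_mk0]; exact D.norm_q_lt_one
  -- `f` as an additive monoid homomorphism
  let F : (W.baseChange ℚ_[p]).toAffine.Point →+
      Additive (ℚ_[p]ˣ ⧸ Subgroup.zpowers (Units.mk0 D.q D.q_ne_zero)) :=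
    AddMonoidHom.mk' f hadd
  have hF : ∀ P, F P = f P := fun _ => rfl
  -- transport through `f`
  have step : (∃ P : (W.baseChange ℚ_[p]).toAffine.Point, P ≠ 0 ∧ p • P = 0) ↔
      ∃ y : Additive (ℚ_[p]ˣ ⧸ Subgroup.zpowers (Units.mk0 D.q D.q_ne_zero)),
        y ≠ 0 ∧ p • y = 0 := by
    constructor
    · rintro ⟨P, hP0, hPp⟩
      refine ⟨F P, fun h ↦ hP0 (hbij.1 ((hF P).symm.trans (h.trans (map_zero F).symm))), ?_⟩
      rw [← map_nsmul, hPp, map_zero]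
    · rintro ⟨y, hy0, hyp⟩
      obtain ⟨P, hP⟩ := hbij.2 y
      refine ⟨P, fun h ↦ hy0 (by rw [← hP, h]; exact map_zero F), hbij.1 ?_⟩
      change F (p • P) = F 0
      rw [map_nsmul, map_zero, hF, hP, hyp]
  rw [step, exists_torsion_additive_iff hp2 hq]
  -- units versus field elements
  constructor
  · rintro ⟨u, hu⟩
    refine ⟨(u : ℚ_[p]), ?_⟩
    rw [← Units.val_pow_eq_pow_val, hu, Units.val_mk0]
  · rintro ⟨u, hu⟩
    have hu0 : u ≠ 0 := by
      rintro rfl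
      rw [zero_pow hp.out.ne_zero] at hu
      exact D.q_ne_zero hu.symm
    refine ⟨Units.mk0 u hu0, Units.val_injective ?_⟩
    rw [Units.val_pow_eq_pow_val, Units.val_mk0, hu, Units.val_mk0]

/-- **`E(ℚ_p)[p] = 0` at a split multiplicative odd `p` iff the Tate parameter is NOT a `p`-th
power** (`∀ P ∈ E(ℚ_p), pP = O → P = O ⟺ ¬ ∃ u, u^p = q_E`) — the decision of the hypothesis
"`E(ℚ_p)[p] = 0`" (Skinner–Zhang Thm. 1.1 (b); Castella's erratum Thm. A′ (2)) at a split prime, and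
of non-membership in the sprint's Tate-power set `T_p`. CONDITIONAL on `hT`.
[cite: SilvermanATAEC1994, Thm. V.3.1 (d) and Thm. V.5.3] [cite: Serre1973, Ch. II §3.2 Thm. 2]
[cite: SkinnerZhang2014, Thm. 1.1 (b)] -/
theorem forall_prime_smul_eq_zero_iff_not_exists_pow_eq_tateParameter
    (hT : tateUniformization_points) (hp2 : p ≠ 2) (D : WeierstrassCurve.TateParameterData W p) :
    (∀ P : (W.baseChange ℚ_[p]).toAffine.Point, p • P = 0 → P = 0) ↔
      ¬ ∃ u : ℚ_[p], u ^ p = D.q := by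
  rw [← prime_torsion_ne_zero_iff_exists_pow_eq_tateParameter W hT hp2 D]
  constructor
  · rintro h ⟨P, hP0, hPp⟩
    exact hP0 (h P hPp)
  · intro h P hPp
    by_contra hP0
    exact h ⟨P, hP0, hPp⟩

/-- Cardinality currency: **`#E(ℚ_p)[p] = 1 ⟺ q_E ∉ (ℚ_p)^p`** at a split multiplicative odd `p`
(`E(ℚ_p)[p]` = the kernel of multiplication by `p` on Mathlib's `ℚ_p`-points of `W⁄ℚ_p`), the
local input of `SelmerLocalRestrictionKernel.natCard_selmerGroup_le_prime_mul_of_natCard_torsion_eq_one`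
(up to `ℚ_v ≅ ℚ_p`). CONDITIONAL on `hT`.
[cite: SilvermanATAEC1994, Thm. V.3.1 (d) and Thm. V.5.3] [cite: Serre1973, Ch. II §3.2 Thm. 2] -/
theorem natCard_ker_nsmul_eq_one_iff_not_exists_pow_eq_tateParameter
    (hT : tateUniformization_points) (hp2 : p ≠ 2) (D : WeierstrassCurve.TateParameterData W p) :
    Nat.card (nsmulAddMonoidHom p : (W.baseChange ℚ_[p]).toAffine.Point →+ _).ker = 1 ↔
      ¬ ∃ u : ℚ_[p], u ^ p = D.q := by
  rw [← forall_prime_smul_eq_zero_iff_not_exists_pow_eq_tateParameter W hT hp2 D,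
    AddSubgroup.card_eq_one, AddSubgroup.eq_bot_iff_forall]
  simp only [AddMonoidHom.mem_ker, nsmulAddMonoidHom_apply]

end Curve

end Literature.NumberTheory.EllipticCurves

end
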